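import Mathlib
import Literature.Analysis.Complex.LaplaceHalfLineFourier
import Literature.Analysis.DeBrangesSpaces.HardyPaleyWiener
import Literature.Analysis.FunctionSpaces.PlancherelL1L2
import Summits.AnomalousDissipation.AnomalousDissipation.Theorems.SoloBlindWeightedMassBound

/-!
# Solo-blind kernel #266 — the shifted-line mass bound (the `[A′](a)` identity)

Programme: SEIL-F / STEADY DOOR, block `[A′]` (derivative-free assembly of the renewal estimate in
regime (II)).  The analytic heart of `[A′]` is the following classical fact, proved here from the
tree's Paley–Wiener theorem for `H²` of a half-plane (`exists_halfLine_laplace_of_hardy`), Plancherel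
for `L¹ ∩ L²` (`integral_norm_sq_fourierIntegral_eq`) and kernel #261 (`weighted_mass_le`):

Let `k : ℝ → ℂ` be continuous with `‖k t‖ ≤ K e^{γt}` on `t ≥ 0`, so that its Laplace transform
`𝓛k(s) = ∫₀^∞ e^{−st} k(t) dt` converges absolutely for `Re s > γ`.  Suppose `𝓛k` continues
analytically to a function `F` on the half-plane `{Re s > a}` (typically `a < 0 ≤ γ`: continuation to
the LEFT of the axis) which is `H²` there: `sup_{σ > a} ∫ ‖F(σ + iy)‖² dy ≤ M² < ∞`.  Then

* `k_ae_eq` — `k(x) = ψ(x) e^{ax}` a.e. on `(0,∞)` for the Paley–Wiener density `ψ ∈ L²` of the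
  rotated function `w ↦ F(a − iw)`; hence
* `weightedL2_le` — `∫₀^∞ ‖k(t)‖² e^{−2at} dt ≤ M²/(2π)` (in particular `k e^{−a·} ∈ L²(0,∞)`);
* `line_identity` — for every `σ > a`, EXACTLY `∫ ‖F(σ+iy)‖² dy = 2π ∫₀^∞ ‖k(t)‖² e^{−2σt} dt`
  (so the qualitative `H²` hypothesis is only used to get the representation; the quantitative input
  is a single line integral);
* `shifted_line_mass_le` — for `σ > a`, `γ₂ > 0`:
  `∫₀^∞ ‖k(t)‖ e^{(−σ−γ₂)t} dt ≤ √( ((2π)⁻¹ ∫ ‖F(σ+iy)‖² dy) / (2γ₂) )`.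

In `[A′]` (ENGINE-L-SPEC §13(a)) this is applied with `k = k_R` (the regular part of the renewal
kernel), `σ = −γ′ = −(γ_ε + γ₂)`, `γ₂ = y_L·sc`: the weight becomes `e^{γ_ε t}` and the right-hand
side is `√(Q₀′/(2γ₂))` with `Q₀′ = (2π)⁻¹ ∫ |R(−γ′ + iω)|² dω` the certified line integral; the
hypothesis "`F` is `H²` on some half-plane `{Re s > a}`, `a < −γ′`" is LEMMA P (analyticity of
`k̂_V` on `{Im x > −y_P}`, `y_P > y_L`, with `O(1/|x|)` decay).  No circularity: the `L²`-ness of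
`k e^{γ′ t}` is a CONCLUSION (Paley–Wiener), not an assumption.
-/

noncomputable section

namespace Summit.AnomalousDissipation.SoloBlind.ShiftedLineMass

open MeasureTheory Complex Set Filter
open scoped Topology FourierTransform Real

open Literature.Analysis.Complex

variable {k : ℝ → ℂ} {K γ a M : ℝ} {F : ℂ → ℂ}

/-! ### 1. The rotated function `w ↦ F(a − iw)` on the upper half-plane -/

/-- `Re(a − iw) = a + Im w`. -/
theorem re_rot (a : ℝ) (w : ℂ) : ((a : ℂ) - I * w).re = a + w.im := by
  simp [Complex.mul_re]

/-- The rotation maps the horizontal line `Im w = y` onto the vertical line `Re s = a + y`. -/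
theorem rot_line_pt (a x y : ℝ) :
    (a : ℂ) - I * ((x : ℂ) + (y : ℂ) * I) = ((a + y : ℝ) : ℂ) + ((-x : ℝ) : ℂ) * I := by
  apply Complex.ext
  · simp [Complex.mul_re, Complex.mul_im]
  · simp [Complex.mul_re, Complex.mul_im]

/-- `w ↦ F(a − iw)` is holomorphic on the upper half-plane. -/
theorem differentiableOn_rot (hF : DifferentiableOn ℂ F {s : ℂ | a < s.re}) :
    DifferentiableOn ℂ (fun w : ℂ => F ((a : ℂ) - I * w)) {w : ℂ | 0 < w.im} := by
  refine hF.comp (by fun_prop) fun w hw => ?_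
  simp only [mem_setOf_eq] at hw ⊢
  rw [re_rot]; linarith

/-- Square-integrability of `w ↦ F(a − iw)` on horizontal lines. -/
theorem integrable_rot_line (hI : ∀ σ : ℝ, a < σ → Integrable (fun t : ℝ => ‖F (σ + t * I)‖ ^ 2))
    {y : ℝ} (hy : 0 < y) :
    Integrable (fun x : ℝ => ‖F ((a : ℂ) - I * (x + y * I))‖ ^ 2) := by
  have h := (hI (a + y) (by linarith)).comp_neg
  refine h.congr (Eventually.of_forall fun x => ?_)
  simp only [rot_line_pt]

/-- The Hardy bound for `w ↦ F(a − iw)` on horizontal lines. -/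
theorem lineBound_rot (hB : ∀ σ : ℝ, a < σ → ∫ y : ℝ, ‖F (σ + y * I)‖ ^ 2 ≤ M ^ 2) {y : ℝ}
    (hy : 0 < y) : ∫ x : ℝ, ‖F ((a : ℂ) - I * (x + y * I))‖ ^ 2 ≤ M ^ 2 := by
  have e : ∫ x : ℝ, ‖F ((a : ℂ) - I * (x + y * I))‖ ^ 2
      = ∫ x : ℝ, ‖F (((a + y : ℝ) : ℂ) + x * I)‖ ^ 2 := by
    rw [← integral_neg_eq_self (fun x : ℝ => ‖F (((a + y : ℝ) : ℂ) + x * I)‖ ^ 2) volume]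
    refine integral_congr_ae (Eventually.of_forall fun x => ?_)
    simp only [rot_line_pt]
  rw [e]; exact hB (a + y) (by linarith)

/-! ### 2. Paley–Wiener representation of the rotated function -/

/-- **Paley–Wiener density.**  Under the `H²` hypothesis on `{Re s > a}` there is `ψ ∈ L²(ℝ)`,
`ψ = 0` a.e. on `(−∞,0)`, `2π‖ψ‖₂² ≤ M²`, with `F(a − iw) = ∫₀^∞ ψ(x) e^{iwx} dx` for `Im w > 0`. -/
theorem exists_psi (hM : 0 ≤ M) (hF : DifferentiableOn ℂ F {s : ℂ | a < s.re})
    (hI : ∀ σ : ℝ, a < σ → Integrable (fun y : ℝ => ‖F (σ + y * I)‖ ^ 2))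
    (hB : ∀ σ : ℝ, a < σ → ∫ y : ℝ, ‖F (σ + y * I)‖ ^ 2 ≤ M ^ 2) :
    ∃ ψ : ℝ → ℂ, MemLp ψ 2 volume ∧ (∀ᵐ x : ℝ, x < 0 → ψ x = 0) ∧
      2 * π * ∫ x : ℝ, ‖ψ x‖ ^ 2 ≤ M ^ 2 ∧
      ∀ w : ℂ, 0 < w.im → ∫ x in Ioi (0 : ℝ), ψ x * cexp (I * w * x) = F ((a : ℂ) - I * w) :=
  Literature.Analysis.DeBrangesSpaces.exists_halfLine_laplace_of_hardy
    (G := fun w : ℂ => F ((a : ℂ) - I * w)) (differentiableOn_rot hF)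
    (fun _ hy => integrable_rot_line hI hy) (fun _ hy => lineBound_rot hB hy) hM

/-! ### 3. Identification of the density with `k` -/

/-- `x ↦ 1_{(0,∞)}(x) ψ(x) e^{−cx}` is in `L²` for `c ≥ 0`. -/
theorem memLp_indicator_mul_cexp {ψ : ℝ → ℂ} (hψ : MemLp ψ 2 volume) {c : ℝ} (hc : 0 ≤ c) :
    MemLp ((Ioi (0 : ℝ)).indicator fun x : ℝ => ψ x * cexp (-(c : ℂ) * x)) 2 volume := by
  refine MemLp.of_le hψ ?_ (Eventually.of_forall fun x => ?_)
  · exact (hψ.1.mul (by fun_prop : Continuous fun x : ℝ => cexp (-(c : ℂ) * x)).aestronglyMeasurable).indicator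
      measurableSet_Ioi
  · by_cases hx : x ∈ Ioi (0 : ℝ)
    · rw [indicator_of_mem hx, norm_mul]
      have hn : ‖cexp (-(c : ℂ) * x)‖ = Real.exp (-c * x) := by
        rw [Complex.norm_exp]; congr 1; simp
      rw [hn]
      have hx' : 0 < x := hx
      have h1 : Real.exp (-c * x) ≤ 1 := Real.exp_le_one_iff.2 (by nlinarith)
      calc ‖ψ x‖ * Real.exp (-c * x) ≤ ‖ψ x‖ * 1 := by gcongr
        _ = ‖ψ x‖ := mul_one _
    · rw [indicator_of_notMem hx, norm_zero]; exact norm_nonneg _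

/-- `x ↦ 1_{(0,∞)}(x) ψ(x) e^{−cx}` is integrable for `c > 0` (Cauchy–Schwarz). -/
theorem integrable_indicator_mul_cexp {ψ : ℝ → ℂ} (hψ : MemLp ψ 2 volume) {c : ℝ} (hc : 0 < c) :
    Integrable ((Ioi (0 : ℝ)).indicator fun x : ℝ => ψ x * cexp (-(c : ℂ) * x)) := by
  rw [integrable_indicator_iff measurableSet_Ioi]
  have hw : 0 < ((c : ℂ) * I).im := by simp [hc]
  have h := Literature.Analysis.DeBrangesSpaces.integrableOn_mul_cexp_Ioi_of_memLp hψ hw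
  refine h.congr_fun (fun x _ => ?_) measurableSet_Ioi
  have e : I * ((c : ℂ) * I) * (x : ℂ) = -(c : ℂ) * x := by
    linear_combination ((c : ℂ) * x) * Complex.I_mul_I
  simp only [e]

/-- **Identification.**  If moreover `F = 𝓛k` far to the right (`k` of exponential order `γ`), then
`k(x) = ψ(x) e^{ax}` for a.e. `x > 0`. -/
theorem k_ae_eq (hk : HalfLineExpBound k K γ)
    (hFk : ∀ s : ℂ, γ < s.re → a < s.re → F s = laplaceC k s)
    {ψ : ℝ → ℂ} (hψ : MemLp ψ 2 volume)
    (hrep : ∀ w : ℂ, 0 < w.im → ∫ x in Ioi (0 : ℝ), ψ x * cexp (I * w * x) = F ((a : ℂ) - I * w)) :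
    ∀ᵐ x : ℝ, 0 < x → k x = ψ x * cexp ((a : ℂ) * x) := by
  obtain ⟨σ₀, hσγ, hσa⟩ : ∃ σ₀ : ℝ, γ < σ₀ ∧ a < σ₀ :=
    ⟨max γ a + 1, by linarith [le_max_left γ a], by linarith [le_max_right γ a]⟩
  have hc0 : 0 < σ₀ - a := by linarith
  set ψ₁ : ℝ → ℂ := (Ioi (0 : ℝ)).indicator fun x : ℝ => ψ x * cexp (-((σ₀ - a : ℝ) : ℂ) * x)
    with hψ₁
  have h1 : MemLp ψ₁ 2 volume := memLp_indicator_mul_cexp hψ hc0.le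
  have h2 : MemLp (bromwichDensity k σ₀) 2 volume := hk.memLp_two_bromwichDensity hσγ
  have h10 : ∀ᵐ x : ℝ, x < 0 → ψ₁ x = 0 := Eventually.of_forall fun x hx => by
    rw [hψ₁, indicator_of_notMem]
    simp only [mem_Ioi, not_lt]; exact hx.le
  have h20 : ∀ᵐ x : ℝ, x < 0 → bromwichDensity k σ₀ x = 0 := Eventually.of_forall fun x hx => by
    rw [bromwichDensity, indicator_of_notMem, smul_zero]
    simp only [mem_Ici, not_le]; exact hx
  have heq : ∀ w : ℂ, 0 < w.im → ∫ x in Ioi (0 : ℝ), ψ₁ x * cexp (I * w * x)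
      = ∫ x in Ioi (0 : ℝ), bromwichDensity k σ₀ x * cexp (I * w * x) := by
    intro w hw
    -- left: the representation at the shifted point `w + (σ₀ − a) i`
    have hw' : 0 < (w + ((σ₀ - a : ℝ) : ℂ) * I).im := by
      have : (w + ((σ₀ - a : ℝ) : ℂ) * I).im = w.im + (σ₀ - a) := by simp
      rw [this]; linarith
    have L : ∫ x in Ioi (0 : ℝ), ψ₁ x * cexp (I * w * x) = F ((σ₀ : ℂ) - I * w) := by
      have e1 : ∫ x in Ioi (0 : ℝ), ψ₁ x * cexp (I * w * x)
          = ∫ x in Ioi (0 : ℝ), ψ x * cexp (I * (w + ((σ₀ - a : ℝ) : ℂ) * I) * x) := by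
        refine setIntegral_congr_fun measurableSet_Ioi fun x hx => ?_
        rw [hψ₁, indicator_of_mem hx, mul_assoc, ← Complex.exp_add]
        congr 2
        push_cast
        linear_combination (-((σ₀ - a : ℂ) * x)) * Complex.I_mul_I
      rw [e1, hrep _ hw']
      congr 1
      push_cast
      linear_combination ((a : ℂ) - σ₀) * Complex.I_mul_I
    -- right: the absolutely convergent Laplace integral at `σ₀ − iw`
    have R : ∫ x in Ioi (0 : ℝ), bromwichDensity k σ₀ x * cexp (I * w * x) = F ((σ₀ : ℂ) - I * w) := by
      have hs1 : γ < ((σ₀ : ℂ) - I * w).re := by rw [re_rot]; linarith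
      have hs2 : a < ((σ₀ : ℂ) - I * w).re := by rw [re_rot]; linarith
      rw [hFk _ hs1 hs2, laplaceC]
      refine setIntegral_congr_fun measurableSet_Ioi fun x hx => ?_
      have hx' : x ∈ Ici (0 : ℝ) := mem_Ici.2 (le_of_lt hx)
      rw [bromwichDensity, indicator_of_mem hx', Complex.real_smul, Complex.ofReal_exp, mul_right_comm,
        ← Complex.exp_add]
      congr 2
      push_cast
      ring
    rw [L, R]
  have hae := Literature.Analysis.DeBrangesSpaces.ae_eq_of_halfLine_laplace_eq h1 h2 h10 h20 heq
  filter_upwards [hae] with x hx hxpos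
  rw [hψ₁, indicator_of_mem (mem_Ioi.2 hxpos), bromwichDensity, indicator_of_mem (mem_Ici.2 hxpos.le),
    Complex.real_smul, Complex.ofReal_exp] at hx
  -- hx : ψ x * cexp (-(σ₀-a) x) = cexp (-σ₀ x) * k x
  have e2 : k x = cexp ((σ₀ : ℂ) * x) * (cexp (((-σ₀ * x : ℝ) : ℂ)) * k x) := by
    rw [← mul_assoc, ← Complex.exp_add]
    have : (σ₀ : ℂ) * x + ((-σ₀ * x : ℝ) : ℂ) = 0 := by push_cast; ring
    rw [this, Complex.exp_zero, one_mul]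
  rw [e2, ← hx, mul_left_comm, ← Complex.exp_add]
  congr 2
  push_cast
  ring

/-- Consequence: `‖ψ x‖² = ‖k x‖² e^{−2ax}` for a.e. `x > 0`. -/
theorem norm_sq_ae_eq {ψ : ℝ → ℂ} (hae : ∀ᵐ x : ℝ, 0 < x → k x = ψ x * cexp ((a : ℂ) * x)) :
    ∀ᵐ x : ℝ, 0 < x → ‖ψ x‖ ^ 2 = ‖k x‖ ^ 2 * Real.exp (-(2 * a) * x) := by
  filter_upwards [hae] with x hx hxpos
  have hn : ‖cexp ((a : ℂ) * x)‖ = Real.exp (a * x) := by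
    rw [Complex.norm_exp]; congr 1; simp
  rw [hx hxpos, norm_mul, hn, mul_pow, mul_assoc]
  have : Real.exp (a * x) ^ 2 * Real.exp (-(2 * a) * x) = 1 := by
    rw [← Real.exp_nat_mul, ← Real.exp_add]
    have : ((2 : ℕ) : ℝ) * (a * x) + -(2 * a) * x = 0 := by push_cast; ring
    rw [this, Real.exp_zero]
  rw [this, mul_one]

/-! ### 4. The weighted `L²` bound at the edge -/

/-- **Weighted `L²` bound.**  `∫₀^∞ ‖k‖² e^{−2at} ≤ M²/(2π)` (and the integrand is integrable). -/
theorem weightedL2_le (hk : HalfLineExpBound k K γ) (hM : 0 ≤ M)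
    (hF : DifferentiableOn ℂ F {s : ℂ | a < s.re})
    (hI : ∀ σ : ℝ, a < σ → Integrable (fun y : ℝ => ‖F (σ + y * I)‖ ^ 2))
    (hB : ∀ σ : ℝ, a < σ → ∫ y : ℝ, ‖F (σ + y * I)‖ ^ 2 ≤ M ^ 2)
    (hFk : ∀ s : ℂ, γ < s.re → a < s.re → F s = laplaceC k s) :
    IntegrableOn (fun x : ℝ => ‖k x‖ ^ 2 * Real.exp (-(2 * a) * x)) (Ioi 0) ∧
      ∫ x in Ioi (0 : ℝ), ‖k x‖ ^ 2 * Real.exp (-(2 * a) * x) ≤ M ^ 2 / (2 * π) := by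
  obtain ⟨ψ, hψ, hψ0, hψM, hrep⟩ := exists_psi hM hF hI hB
  have hae := norm_sq_ae_eq (k_ae_eq hk hFk hψ hrep)
  have hsq : Integrable (fun x : ℝ => ‖ψ x‖ ^ 2) := (memLp_two_iff_integrable_sq_norm hψ.1).1 hψ
  have haer : ∀ᵐ x ∂(volume.restrict (Ioi (0 : ℝ))), ‖ψ x‖ ^ 2 = ‖k x‖ ^ 2 * Real.exp (-(2 * a) * x) :=
    (ae_restrict_iff' measurableSet_Ioi).2 (hae.mono fun x hx hxm => hx hxm)
  refine ⟨hsq.restrict.congr haer, ?_⟩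
  rw [← integral_congr_ae haer]
  calc ∫ x in Ioi (0 : ℝ), ‖ψ x‖ ^ 2 ≤ ∫ x : ℝ, ‖ψ x‖ ^ 2 :=
        setIntegral_le_integral hsq (Eventually.of_forall fun x => by positivity)
    _ ≤ M ^ 2 / (2 * π) := by
        rw [le_div_iff₀ Real.two_pi_pos]; linarith

/-! ### 5. The exact line identity (Plancherel on `Re s = σ > a`) -/

/-- **Line identity.**  For `σ > a`: `t ↦ ‖k t‖² e^{−2σt}` is integrable on `(0,∞)` and
`∫ ‖F(σ + iy)‖² dy = 2π ∫₀^∞ ‖k t‖² e^{−2σt} dt`. -/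
theorem line_identity (hk : HalfLineExpBound k K γ) (hM : 0 ≤ M)
    (hF : DifferentiableOn ℂ F {s : ℂ | a < s.re})
    (hI : ∀ σ : ℝ, a < σ → Integrable (fun y : ℝ => ‖F (σ + y * I)‖ ^ 2))
    (hB : ∀ σ : ℝ, a < σ → ∫ y : ℝ, ‖F (σ + y * I)‖ ^ 2 ≤ M ^ 2)
    (hFk : ∀ s : ℂ, γ < s.re → a < s.re → F s = laplaceC k s) {σ : ℝ} (hσ : a < σ) :
    IntegrableOn (fun x : ℝ => ‖k x‖ ^ 2 * Real.exp (-(2 * σ) * x)) (Ioi 0) ∧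
      ∫ y : ℝ, ‖F (σ + y * I)‖ ^ 2 = 2 * π * ∫ x in Ioi (0 : ℝ), ‖k x‖ ^ 2 * Real.exp (-(2 * σ) * x) := by
  obtain ⟨ψ, hψ, hψ0, hψM, hrep⟩ := exists_psi hM hF hI hB
  have hae := norm_sq_ae_eq (k_ae_eq hk hFk hψ hrep)
  have hc : 0 < σ - a := by linarith
  -- the `L¹ ∩ L²` function `φ = 1_{(0,∞)} ψ e^{−(σ−a)x}`
  set φ : ℝ → ℂ := (Ioi (0 : ℝ)).indicator fun x : ℝ => ψ x * cexp (-((σ - a : ℝ) : ℂ) * x) with hφ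
  have hφ1 : Integrable φ := integrable_indicator_mul_cexp hψ hc
  have hφ2 : MemLp φ 2 volume := memLp_indicator_mul_cexp hψ hc.le
  -- pointwise: `‖φ x‖² = 1_{(0,∞)} ‖ψ x‖² e^{−2(σ−a)x}`
  have hφn : ∀ x : ℝ, ‖φ x‖ ^ 2
      = (Ioi (0 : ℝ)).indicator (fun x : ℝ => ‖ψ x‖ ^ 2 * Real.exp (-(2 * (σ - a)) * x)) x := by
    intro x
    by_cases hx : x ∈ Ioi (0 : ℝ)
    · rw [hφ, indicator_of_mem hx, indicator_of_mem hx, norm_mul, mul_pow]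
      have hn : ‖cexp (-((σ - a : ℝ) : ℂ) * x)‖ = Real.exp (-(σ - a) * x) := by
        rw [Complex.norm_exp]; congr 1; simp
      rw [hn, ← Real.exp_nat_mul]
      congr 2; push_cast; ring
    · rw [hφ, indicator_of_notMem hx, indicator_of_notMem hx, norm_zero]; ring
  -- a.e. on `(0,∞)`: `‖ψ‖² e^{−2(σ−a)x} = ‖k‖² e^{−2σx}`
  have haer : ∀ᵐ x ∂(volume.restrict (Ioi (0 : ℝ))),
      ‖ψ x‖ ^ 2 * Real.exp (-(2 * (σ - a)) * x) = ‖k x‖ ^ 2 * Real.exp (-(2 * σ) * x) := by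
    refine (ae_restrict_iff' measurableSet_Ioi).2 (hae.mono fun x hx hxm => ?_)
    rw [hx hxm, mul_assoc, ← Real.exp_add]
    congr 2; ring
  -- integrability of `‖k‖² e^{−2σx}` on `(0,∞)`
  have hInt : IntegrableOn (fun x : ℝ => ‖ψ x‖ ^ 2 * Real.exp (-(2 * (σ - a)) * x)) (Ioi 0) := by
    have h := (memLp_two_iff_integrable_sq_norm hφ2.1).1 hφ2
    simp_rw [hφn] at h
    exact (integrable_indicator_iff measurableSet_Ioi).1 h
  refine ⟨hInt.congr haer, ?_⟩
  -- the Fourier transform of `φ` is the line value of `F`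
  have hFT : ∀ ξ : ℝ, 𝓕 φ ξ = F ((σ : ℂ) + ((2 * π * ξ : ℝ) : ℂ) * I) := by
    intro ξ
    have hw : 0 < ((((-(2 * π * ξ)) : ℝ) : ℂ) + ((σ - a : ℝ) : ℂ) * I).im := by
      have : ((((-(2 * π * ξ)) : ℝ) : ℂ) + ((σ - a : ℝ) : ℂ) * I).im = σ - a := by simp
      rw [this]; exact hc
    rw [Real.fourier_real_eq_integral_exp_smul]
    have h1 : ∀ v : ℝ, cexp (↑(-2 * π * v * ξ) * I) • φ v = (Ioi (0 : ℝ)).indicator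
        (fun v : ℝ => ψ v * cexp (I * ((((-(2 * π * ξ)) : ℝ) : ℂ) + ((σ - a : ℝ) : ℂ) * I) * v)) v := by
      intro v
      by_cases hv : v ∈ Ioi (0 : ℝ)
      · rw [hφ, indicator_of_mem hv, indicator_of_mem hv, smul_eq_mul, mul_left_comm, mul_assoc,
          ← Complex.exp_add]
        congr 2
        push_cast
        linear_combination (-((σ - a : ℂ) * v)) * Complex.I_mul_I
      · rw [hφ, indicator_of_notMem hv, indicator_of_notMem hv, smul_zero]
    simp_rw [h1]
    rw [integral_indicator measurableSet_Ioi, hrep _ hw]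
    congr 1
    push_cast
    linear_combination ((a : ℂ) - σ) * Complex.I_mul_I
  -- Plancherel and the substitution `y = 2πξ`
  have hP := Literature.Analysis.FunctionSpaces.integral_norm_sq_fourierIntegral_eq hφ1 hφ2
  have h3 : ∫ ξ : ℝ, ‖𝓕 φ ξ‖ ^ 2 = (2 * π)⁻¹ * ∫ y : ℝ, ‖F (σ + y * I)‖ ^ 2 := by
    have h := Measure.integral_comp_mul_left (fun y : ℝ => ‖F ((σ : ℂ) + (y : ℂ) * I)‖ ^ 2) (2 * π)
    rw [abs_of_pos (inv_pos.2 Real.two_pi_pos), smul_eq_mul] at h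
    rw [← h]
    refine integral_congr_ae (Eventually.of_forall fun ξ => ?_)
    simp only [hFT ξ]
  have h4 : ∫ x : ℝ, ‖φ x‖ ^ 2 = ∫ x in Ioi (0 : ℝ), ‖k x‖ ^ 2 * Real.exp (-(2 * σ) * x) := by
    simp_rw [hφn]
    rw [integral_indicator measurableSet_Ioi]
    exact integral_congr_ae haer
  rw [hP, h4] at h3
  have hπ : (2 * π : ℝ) ≠ 0 := Real.two_pi_pos.ne'
  rw [h3, ← mul_assoc, mul_inv_cancel₀ hπ, one_mul]

/-! ### 6. The shifted-line mass bound -/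

/-- **Shifted-line mass bound** (`[A′](a)`).  For `σ > a` and `γ₂ > 0`,
`∫₀^∞ ‖k t‖ e^{(−σ−γ₂)t} dt ≤ √( ((2π)⁻¹ ∫ ‖F(σ+iy)‖² dy) / (2γ₂) )`. -/
theorem shifted_line_mass_le (hk : HalfLineExpBound k K γ) (hM : 0 ≤ M)
    (hF : DifferentiableOn ℂ F {s : ℂ | a < s.re})
    (hI : ∀ σ : ℝ, a < σ → Integrable (fun y : ℝ => ‖F (σ + y * I)‖ ^ 2))
    (hB : ∀ σ : ℝ, a < σ → ∫ y : ℝ, ‖F (σ + y * I)‖ ^ 2 ≤ M ^ 2)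
    (hFk : ∀ s : ℂ, γ < s.re → a < s.re → F s = laplaceC k s) {σ : ℝ} (hσ : a < σ)
    {γ₂ : ℝ} (hγ₂ : 0 < γ₂) :
    ∫ t in Ioi (0 : ℝ), ‖k t‖ * Real.exp ((-σ - γ₂) * t)
      ≤ Real.sqrt (((2 * π)⁻¹ * ∫ y : ℝ, ‖F (σ + y * I)‖ ^ 2) / (2 * γ₂)) := by
  obtain ⟨hi, hid⟩ := line_identity hk hM hF hI hB hFk hσ
  have hexp : ∀ t : ℝ, 2 * (-σ - γ₂ + γ₂) * t = -(2 * σ) * t := fun t => by ring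
  refine Summit.AnomalousDissipation.SoloBlind.WeightedMassBound.weighted_mass_le
    (f := fun t : ℝ => ‖k t‖) (a := -σ - γ₂) (Q := (2 * π)⁻¹ * ∫ y : ℝ, ‖F (σ + y * I)‖ ^ 2)
    hγ₂ (fun t => norm_nonneg _) ?_ ?_
  · refine hi.congr_fun (fun t _ => ?_) measurableSet_Ioi
    simp only [hexp]
  · have e : ∫ t in Ioi (0 : ℝ), (fun t : ℝ => ‖k t‖) t ^ 2 * Real.exp (2 * (-σ - γ₂ + γ₂) * t)
        = ∫ t in Ioi (0 : ℝ), ‖k t‖ ^ 2 * Real.exp (-(2 * σ) * t) := by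
      refine integral_congr_ae (Eventually.of_forall fun t => ?_)
      simp only [hexp]
    rw [e]
    have hπ : (0 : ℝ) < 2 * π := Real.two_pi_pos
    rw [hid, ← mul_assoc, inv_mul_cancel₀ hπ.ne', one_mul]

/-- **`[A′](a)` in programme notation.**  With `γ' = γ_ε + γ₂` (`γ₂ > 0`) and `F` the continuation
of `𝓛k` to an `H²` function on a half-plane `{Re s > a}` with `a < −γ'`:
`∫₀^∞ ‖k t‖ e^{γ_ε t} dt ≤ √(Q₀′/(2γ₂))`, `Q₀′ = (2π)⁻¹ ∫ ‖F(−γ' + iω)‖² dω`. -/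
theorem Aprime_mass_le (hk : HalfLineExpBound k K γ) (hM : 0 ≤ M)
    (hF : DifferentiableOn ℂ F {s : ℂ | a < s.re})
    (hI : ∀ σ : ℝ, a < σ → Integrable (fun y : ℝ => ‖F (σ + y * I)‖ ^ 2))
    (hB : ∀ σ : ℝ, a < σ → ∫ y : ℝ, ‖F (σ + y * I)‖ ^ 2 ≤ M ^ 2)
    (hFk : ∀ s : ℂ, γ < s.re → a < s.re → F s = laplaceC k s)
    {γε γ₂ : ℝ} (hγ₂ : 0 < γ₂) (ha : a < -(γε + γ₂)) :
    ∫ t in Ioi (0 : ℝ), ‖k t‖ * Real.exp (γε * t)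
      ≤ Real.sqrt (((2 * π)⁻¹ * ∫ ω : ℝ, ‖F ((-(γε + γ₂) : ℝ) + ω * I)‖ ^ 2) / (2 * γ₂)) := by
  have h := shifted_line_mass_le hk hM hF hI hB hFk ha hγ₂
  have e : ∀ t : ℝ, (-(-(γε + γ₂)) - γ₂) * t = γε * t := fun t => by ring
  simp_rw [e] at h
  exact h

end Summit.AnomalousDissipation.SoloBlind.ShiftedLineMass
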